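import Summits.Ventures.HSemireg.Pad4TowerDiamondMu4

/-!
line stmt-HodgeConjecture-18881 Cruxes/BlochSeedDiscOne/Lines/birth.lean 814a6a70c14e831a stub_rung_pad4_seedAt

# B136 vs ◇_h — the letters of the `RotatedPairB136` design are NOT `◇_h` letters (plan-lens-HodgeAV-control g16, answer to director-hodge R19.600 (2))

`fourChargedK_absent` (PairSpread v8∕v9) quantifies over `MConfig`s with `C.InDiamond h`: every letter `x = (α; β)` has `β = 0` or `β` ON A COORDINATE
AXIS (a μ₄ letter), even node level `α − |c| ≥ 0` and `α + |c| ≤ h`.  The B136 design (`N = 8·hub⁴ + Σ 16·(ρᵏt)⁴`, `P = Σ (ρᵏu′)^{⊠4}`, `hub = (9;0,0)`,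
`t = (2;−4,3)`, `u′ = (0;4,5) + (4;4,1)`) uses OFF-AXIS Gaussian letters and an apex of ODD level, so none of its 69 cells is a `◇_h` cell for any `h`:
the theorem neither constrains nor is threatened by designs of that shape.  Kernel checks (`decide`): -/

set_option linter.dupNamespace false

namespace Summit.HodgeConjecture.HodgeConjecture.Cruxes.BlochSeedDiscOne.B136Probe

open Summit.Ventures.HSemireg.Pad4Tower

/-- the hub `(9;0,0)`: an apex of odd node level `9` — not in `◇_h` for any `h` (parity clause). -/
theorem hub_not_inDiamond (h : ℤ) : ¬ InDiamond h ((9 : ℤ), ((0 : ℤ), (0 : ℤ))) := by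
  intro ⟨_, _, hpar, _⟩
  revert hpar; decide

/-- `t = (2;−4,3)`: off-axis — not in `◇_h` for any `h` (axis clause). -/
theorem t_not_inDiamond (h : ℤ) : ¬ InDiamond h ((2 : ℤ), ((-4 : ℤ), (3 : ℤ))) := by
  intro ⟨hax, _, _, _⟩
  revert hax; decide

/-- `(0;4,5)` (first letter of `u′`): off-axis. -/
theorem u1_not_inDiamond (h : ℤ) : ¬ InDiamond h ((0 : ℤ), ((4 : ℤ), (5 : ℤ))) := by
  intro ⟨hax, _, _, _⟩
  revert hax; decide

/-- `(4;4,1)` (second letter of `u′`): off-axis. -/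
theorem u2_not_inDiamond (h : ℤ) : ¬ InDiamond h ((4 : ℤ), ((4 : ℤ), (1 : ℤ))) := by
  intro ⟨hax, _, _, _⟩
  revert hax; decide

/-- the rotations `ρᵏ` (`β ↦ iβ`) of `t` and of the `u′`-letters stay off-axis: all twelve rotated letters fail the axis-or-zero clause. -/
theorem rotated_not_axis :
    ∀ p ∈ [((-4 : ℤ), (3 : ℤ)), (-3, -4), (4, -3), (3, 4), (4, 5), (-5, 4), (-4, -5), (5, -4), (4, 1), (-1, 4), (-4, -1), (1, -4)],
      ¬ (p = (0, 0) ∨ ((p.1 ≠ 0 ∧ p.2 = 0) ∨ (p.1 = 0 ∧ p.2 ≠ 0))) := by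
  decide

end Summit.HodgeConjecture.HodgeConjecture.Cruxes.BlochSeedDiscOne.B136Probe
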